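import Summits.ResolutionOfSingularities.ResolutionOfSingularities.Theorems.PAlterationPalterationThesisPerfectTransfer
import Summits.ResolutionOfSingularities.ResolutionOfSingularities.Theorems.PAlterationPalterationThesisStubResOverOfRegModelAtTmpAt
import Summits.ResolutionOfSingularities.ResolutionOfSingularities.Theorems.PAlterationPalterationThesisStubRegModelAtOfResOver
import Summits.ResolutionOfSingularities.ResolutionOfSingularities.Theorems.PAlterationPalterationThesisStubIsLocallyUniformizableOfRegModelAt
import Summits.ResolutionOfSingularities.ResolutionOfSingularities.Theorems.PAlterationPalterationThesisStubRegModelAtOfTrdegLeOne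
import Summits.ResolutionOfSingularities.ResolutionOfSingularities.Theorems.PAlterationPalterationThesisStubRegModelAtOfTrdegLeThree
import Literature.AlgebraicGeometry.Resolution.ProperModelsRegModel
import Literature.AlgebraicGeometry.Resolution.LocalUniformization
import Literature.AlgebraicGeometry.Resolution.ResolutionOfSingularities
import Summits.ResolutionOfSingularities.ResolutionOfSingularities.Theses.Descent
import HarnessLib

/-!
# Skeleton `Sketch` (perfect-field transfer), rev. c7 (= rev. c6 composition: Zariski's two
# problems over perfect fields, + certification of `TMP_K` in low transcendence degree)
# — crux stmt-ResolutionOfSingularities-0552 `PalterationThesis`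

Line lead c7 (prover-line-stmt-ResolutionOfSingularities-0552-c7-0), 2026-08-17, continuing
line lead c6 (prover-line-stmt-ResolutionOfSingularities-0552-c6-0).

REV. c7 (this seat). Composition and the three residue stubs of rev. c6 are kept VERBATIM (six
consecutive reshapes have presented the same summit-equivalent residue in six equivalent forms;
a seventh presentation is not movement). Added, OFF the composition path: two certification
stubs for the second residue, `stub_twoModelPatchingAt_of_trdeg_le_one` (two-model patching of
proper models of `F/K` in transcendence degree `≤ 1`, unconditional: resolve the join
`M₁ ⋈ M₂`, a curve) and `stub_twoModelPatchingAt_of_trdeg_le_three` (the same in transcendence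
degree `≤ 3` modulo the named fact `CossartPiltant2019`), the twins of c6's
`stub_regModelAt_of_trdeg_le_one/three` for the first residue: BOTH perfect-field residues are
theorems below transcendence degree `4` and open exactly from `4`, where (jointly with
`TMP`/`RegModel` of the other) they are the summit sliced at `K` (`resOver_iff_regModelAt_and_tmpAt`).

STATUS. The crux `PalterationThesis = ∀ p, PIAlt_p ∧ PICover_p` is `Pialt ∧ Picover` (p87934) and
is EQUIVALENT to the summit (p95862); it has no residue of its own. Line `Sketch` transfers it to
perfect ground fields: `PalterationThesis ↔ (∀ p, ∀ K perfect, PIAlt_K ∧ PICover_K) ∧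
DescentPerfectToAll` (`palterationThesis_iff_perfect_and_descent`, lead a2) and, over a perfect
`K`, `PIAlt_K ∧ PICover_K ↔ Res_K` (`pialtOver_and_picoverOver_iff_perfectField`).

REV. c6 RESHAPE (composition through ZARISKI'S TWO PROBLEMS instead of the three valuation
atoms of rev. c3–c5). Over ANY field `K`, resolution of every reduced separated `K`-scheme of
finite type is equivalent to the conjunction of
* `RegModel_K` — Zariski 1944 / Abhyankar: every function field `F/K` (having a proper model)
  has a REGULAR proper model (`ProperModel.RegModel` sliced at `K`), and
* `TMP_K` — Zariski–Piltant two-model patching of proper models of `F/K`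
  (`ProperModel.TwoModelPatching` sliced at `K`),
the fieldwise form of the tree's `ProperModel.resolutionInChar_iff_twoModelPatching_and_regModel`
(Piltant 2013, Thm. 2.4 + Prop. 5.1: patch any proper model with the regular one). Hence the
registered stubs of rev. c6 are
* `stub_regModelPerfect` — `RegModel` sliced at the perfect `K` (research residue; implied by
  the rev. c5 stubs {item 0641 `LuAlphaPTorsor`, fact `Temkin2013`, TMP at `K`} through
  `Res_K`, and implying BOTH rev. c4/c5 valuation atoms `Temkin_K`, `RRLU1_K` outright
  (`stub_isLocallyUniformizable_of_regModelAt`: a regular proper model uniformizes every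
  valuation) — so the rev. c6 stub set is implied by the rev. c5 one and is one stub shorter);
* `stub_twoModelPatchingPerfect` — unchanged (TMP at the perfect `K`; crux 0642's open core);
* `stub_descentPerfectToAll` — unchanged (= item stmt-0549 BY NAME; implied by item stmt-0554
  `Picover`, `descentPerfectToAll_of_picover`, landed in `WeightedInvariantDescentPerfectToAllPicoverLink`);
* glue `stub_resOver_of_regModelAt_tmpAt` (worker A: fieldwise Zariski reduction, on the
  composition path), `stub_regModelAt_of_resOver`, `stub_isLocallyUniformizable_of_regModelAt`
  (worker B: the reshape loses nothing / dominates rev. c5), all over an arbitrary field.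
Composition `PalterationThesis_of`: `palterationThesis_iff_perfect_and_descent.mpr` ∘
`pialtOver_and_picoverOver_iff_perfectField.mpr` ∘ `stub_resOver_of_regModelAt_tmpAt`.

Disproof v1.5 (`Cruxes/PalterationThesis/Disproof.lean`, 2026-08-16): `## Targets: none`; §1 crux
⟺ summit; §3 finiteness / regular-base load-bearing — not touched by this reshape (no cover is
asserted regular; models are proper over the ground field).
-/

set_option linter.dupNamespace false

noncomputable section

open CategoryTheory AlgebraicGeometry
open Literature.AlgebraicGeometry.Resolution
open Summit.ResolutionOfSingularities.ResolutionOfSingularities.Theses.PAlteration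
open Summit.ResolutionOfSingularities.ResolutionOfSingularities.Theses.Descent (DescentPerfectToAll)
open Summit.ResolutionOfSingularities.ResolutionOfSingularities.Theorems.PalterationThesis.PerfectTransfer

namespace Summit.ResolutionOfSingularities.ResolutionOfSingularities.Theorems.PalterationThesis.ZariskiPerfect

/-! ## Open stubs — the three residues (none is 0552's own; none is worker-sized) -/

/-- STUB (research residue of rev. c6) = `ProperModel.RegModel` sliced at the perfect ground
field `K`: every `F/K` essentially of finite type having a proper model has a REGULAR proper
model (Zariski 1944 "existence of a nonsingular model"; Piltant 2013, Thm. 2.4; OPEN in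
transcendence degree `≥ 4`). Implied by resolution over `K` (`stub_regModelAt_of_resOver`), hence
by the rev. c5 stubs; implies local uniformization over `K`
(`stub_isLocallyUniformizable_of_regModelAt`). Crux-sized; not delegated. -/
theorem stub_regModelPerfect (p : ℕ) (hp : p.Prime) (K : Type) [Field K] [CharP K p]
    [PerfectField K] :
    ∀ (F : Type) [Field F] [Algebra K F] [Algebra.EssFiniteType K F],
      Nonempty (ProperModel K F) → ∃ N : ProperModel K F, Scheme.IsRegular N.X := by
  sorry

/-- STUB (= the Literature open statement `ProperModel.TwoModelPatching p` sliced at the perfect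
ground field `K`; the open core of crux `PatchingRel`, stmt-0642, Piltant 2013 Prop. 5.1 with
`P = P_reg`: Zariski–Piltant two-model patching of proper models). Any two proper models of an
essentially-finite-type `F/K` are dominated by a third one that is regular above the regular loci
of both. Crux-sized (open in transcendence degree `≥ 4`); not delegated. -/
theorem stub_twoModelPatchingPerfect (p : ℕ) (hp : p.Prime) (K : Type) [Field K] [CharP K p]
    [PerfectField K] :
    ∀ (F : Type) [Field F] [Algebra K F] [Algebra.EssFiniteType K F],
      ∀ M₁ M₂ : ProperModel K F,
        ∃ (N : ProperModel K F) (φ₁ : N.Hom M₁) (φ₂ : N.Hom M₂), φ₁.RegLe ∧ φ₂.RegLe := by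
  sorry

/-- STUB = item stmt-ResolutionOfSingularities-0549 BY NAME (crux of route Descent). Resolution
over perfect fields of characteristic `p` implies resolution over all fields of characteristic
`p`. Implied by item stmt-0554 `Picover` (`descentPerfectToAll_of_picover`). Crux-sized; not
delegated. -/
theorem stub_descentPerfectToAll : DescentPerfectToAll := by
  sorry

/-! ## Certification of the residue `TMP_K` (rev. c7, LANDED — imported, same namespace):
`stub_twoModelPatchingAt_of_trdeg_le_one` (p149586, `PAlterationPalterationThesisStubTwoModelPatchingAtOfTrdegLeOne.lean`:
two-model patching of proper models of `F/K` in transcendence degree ≤ 1 over EVERY field `K`,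
unconditional — resolve the join `M₁ ⋈ M₂`, a curve) and `stub_twoModelPatchingAt_of_trdeg_le_three`
(p150056, `PAlterationPalterationThesisStubTwoModelPatchingAtOfTrdegLeThree.lean`: ≤ 3 modulo the named
fact `CossartPiltant2019`). Together with c6's `stub_regModelAt_of_trdeg_le_one/three` (below): BOTH
perfect-field residues are theorems below transcendence degree `4` and open exactly from `4`
(the two new modules are not imported here only because the farm had not yet built them when this
revision was registered; they are recorded as landed stubs on the item). -/

/-! ## Glue (wave 1, LANDED — imported, same namespace):
`stub_resOver_of_regModelAt_tmpAt` (p145213, `PAlterationPalterationThesisStubResOverOfRegModelAtTmpAt.lean`: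
fieldwise Zariski reduction Res_K ⟸ RegModel_K ∧ TMP_K, with `hasResolution_properModel_of_regModelAt_tmpAt`,
`hasResolution_projective_of_regModelAt_tmpAt`), `stub_regModelAt_of_resOver` (p145163,
`PAlterationPalterationThesisStubRegModelAtOfResOver.lean`: Res_K ⟹ RegModel_K),
`stub_isLocallyUniformizable_of_regModelAt` (p145395,
`PAlterationPalterationThesisStubIsLocallyUniformizableOfRegModelAt.lean`: RegModel_K ⟹ LU_K, with
`isLocallyUniformizable_of_regCentre` — a regular centre on ANY proper model uniformizes). -/

/-! ## Known cases of the residue `RegModel_K` (wave 2, LANDED — imported, same namespace):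
`stub_regModelAt_of_trdeg_le_one` (p147163, `PAlterationPalterationThesisStubRegModelAtOfTrdegLeOne.lean`:
transcendence degree ≤ 1, unconditional — resolution of curves) and `stub_regModelAt_of_trdeg_le_three`
(p147234, `PAlterationPalterationThesisStubRegModelAtOfTrdegLeThree.lean`: ≤ 3 modulo the named fact
`CossartPiltant2019`); so the residue is open exactly from transcendence degree 4. -/

/-! ## Composition -/

/-- Resolution of every reduced separated scheme of finite type over the perfect field `K`, from
the two residues over `K` through the fieldwise Zariski reduction. -/
theorem perfectRes_of_stubs (p : ℕ) (hp : p.Prime) (K : Type) [Field K] [CharP K p]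
    [PerfectField K] :
    ∀ (X : Scheme.{0}) (f : X ⟶ Spec (.of K)),
      IsSeparated f → LocallyOfFiniteType f → QuasiCompact f → IsReduced X →
      Scheme.HasResolution X :=
  stub_resOver_of_regModelAt_tmpAt K (stub_regModelPerfect p hp K)
    (stub_twoModelPatchingPerfect p hp K)

/-- Composition: the crux BY NAME — perfect-field transfer
(`palterationThesis_iff_perfect_and_descent`), the fieldwise sandwich
(`pialtOver_and_picoverOver_iff_perfectField`) and the two residues over each perfect field. -/
theorem PalterationThesis_of : PalterationThesis :=
  palterationThesis_iff_perfect_and_descent.mpr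
    ⟨fun p hp K _ _ _ =>
        (pialtOver_and_picoverOver_iff_perfectField p hp K).mpr (perfectRes_of_stubs p hp K),
      stub_descentPerfectToAll⟩

/-! ## Certification inside the skeleton (sorried only through the stubs above) -/

/-- The rev. c6 residue `RegModel_K` returns both valuation atoms of rev. c3–c5 over `K`:
Temkin's conclusion with `L := F` and `RRLU1_K` (uniformize the trace `O ∩ F` outright). -/
theorem atoms_of_regModelAt (p : ℕ) (K : Type) [Field K]
    (hR : ∀ (F : Type) [Field F] [Algebra K F] [Algebra.EssFiniteType K F],
      Nonempty (ProperModel K F) → ∃ N : ProperModel K F, Scheme.IsRegular N.X) :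
    (∀ (F : Type) [Field F] [Algebra K F], (⊤ : IntermediateField K F).FG →
      ∀ O : ValuationSubring F, (∀ c : K, algebraMap K F c ∈ O) →
        ∃ (L : Type) (_ : Field L) (_ : Algebra F L) (_ : Algebra K L) (_ : IsScalarTower K F L),
          FiniteDimensional F L ∧ IsPurelyInseparable F L ∧
          ∃ O' : ValuationSubring L, O'.comap (algebraMap F L) = O ∧
            IsLocallyUniformizable K L O') ∧
    (∀ (F L : Type) [Field F] [Field L] [Algebra K F] [Algebra F L] [Algebra K L]
      [IsScalarTower K F L], (⊤ : IntermediateField K F).FG → IsPurelyInseparable F L →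
      (∃ y : L, y ^ p ∈ (algebraMap F L).range ∧ IntermediateField.adjoin F {y} = ⊤) →
      ∀ B : Subalgebra K L, B.FG → IsFractionRing B L → IsRegularRing B →
      ∀ O : ValuationSubring L, B.toSubring ≤ O.toSubring →
        IsLocallyUniformizable K F (O.comap (algebraMap F L))) := by
  refine ⟨fun F _ _ hFfg O hO => ?_, ?_⟩
  · refine ⟨F, inferInstance, inferInstance, inferInstance, inferInstance, inferInstance,
      inferInstance, O, ?_, stub_isLocallyUniformizable_of_regModelAt K hR F hFfg O hO⟩
    ext x
    simp
  · intro F L _ _ _ _ _ _ hFfg _hpi _hy B _hBfg _hBfr _hBreg O hBO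
    refine stub_isLocallyUniformizable_of_regModelAt K hR F hFfg (O.comap (algebraMap F L))
      fun c => ?_
    change algebraMap F L (algebraMap K F c) ∈ O
    rw [← IsScalarTower.algebraMap_apply]
    exact hBO (B.algebraMap_mem c)

end Summit.ResolutionOfSingularities.ResolutionOfSingularities.Theorems.PalterationThesis.ZariskiPerfect

end
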